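import Mathlib
import Literature.Analysis.Complex.HolomorphicParametricIntegral
import HarnessLib

/-!
# The complexified-angle chart of a cone-supported Laplace–Fourier measure
(stub `stub_angularChart`, crux `PencilRigidity.ShellRigidity`, line
`transverse-smearing-planar-threshold`)

Informal statement. Let `μ` be a finite measure on energy–momentum space `ℝ⁴` carried by the
forward light cone `{p₀ ≥ |p₁|}` (`μ{p₀ < 0} = 0`, `μ{p₀ < |p₁|} = 0`), `r > 0` a radius, `ε > 0` a
shift and `Ψ > 0` a depth with `ε ≤ r cos(3π/8) e^{-Ψ}`. The symmetrised complexified-angle chart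
`H(w) = ∫ e^{-(r cos w - ε) p₀} cos(r sin w · p₁) dμ(p)` is

1. holomorphic on the rectangle `U = {|Re w| < 3π/8, |Im w| < Ψ}`;
2. bounded there by the Laplace transform of `μ` at time `m_w - ε`, `m_w = r cos(Re w) e^{-|Im w|}`;
3. equal at real `α`, `|α| < 3π/8`, to the average of the two Laplace–Fourier integrals at
   `(t, b) = (r cos α - ε, ± r sin α)`;
4. even;
5. real and nonnegative on the imaginary axis.

Proof. Write `w = α + iψ`. Pointwise, `|e^{-(r cos w - ε)p₀}| = e^{-(r cos α cosh ψ - ε)p₀}`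
(`Re cos(α+iψ) = cos α cosh ψ`) and `|cos z| ≤ e^{|Im z|}` with
`Im(r sin w · p₁) = r cos α sinh ψ · p₁`; on the cone `|p₁| ≤ p₀` and for `cos α ≥ 0` the product is
`≤ exp(-(r cos α (cosh ψ - |sinh ψ|) - ε)p₀) = exp(-(r cos α e^{-|ψ|} - ε)p₀)`, and on `U` we have
`r cos α e^{-|ψ|} ≥ r cos(3π/8) e^{-Ψ} ≥ ε`, so the integrand is bounded by `1` `μ`-a.e., uniformly
on `U`. (1) is then the holomorphy of dominated holomorphic parameter integrals
(`Literature.Analysis.Complex.differentiableOn_integral_of_dominated`), (2) is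
`‖∫ f‖ ≤ ∫ ‖f‖`, (3) is `cos θ = (e^{iθ} + e^{-iθ})/2`, (4) is `cos(-w) = cos w`,
`sin(-w) = -sin w`, and (5) is `cos(iχ) = cosh χ`, `sin(iχ) = i sinh χ`, `cos(ix) = cosh x > 0`.

References: folklore (Paley–Wiener type estimates for Laplace transforms of cone-supported
measures); the holomorphy lemma is the tree file
`Literature/Analysis/Complex/HolomorphicParametricIntegral.lean`.
-/

noncomputable section

namespace Summit.QuantumFields.YangMills.Cruxes.ShellRigidity.TransverseSmearingPlanarThreshold

open MeasureTheory Complex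
open scoped InnerProductSpace

/-! ## Pointwise estimates for the integrand

The helpers live in the sub-namespace `AngularChart` (no collisions with sibling stub files). -/

namespace AngularChart

/-- The complex cosine as the mean of two exponentials. -/
theorem cos_eq_exp (z : ℂ) : Complex.cos z = (cexp (z * I) + cexp (-(z * I))) / 2 := by
  rw [Complex.cos, neg_mul]

/-- Modulus of the exponential factor `e^{-(r cos w - ε) x}`. -/
theorem norm_expFactor (r ε x : ℝ) (w : ℂ) :
    ‖cexp (-(((r : ℂ) * Complex.cos w - (ε : ℂ)) * (x : ℂ)))‖ =
      Real.exp (-((r * (Real.cos w.re * Real.cosh w.im) - ε) * x)) := by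
  -- `Re cos(α + iψ) = cos α · cosh ψ`
  have hre : (Complex.cos w).re = Real.cos w.re * Real.cosh w.im := by
    rw [Complex.cos_eq]
    simp [Complex.cos_ofReal_re, Complex.cosh_ofReal_re, Complex.cos_ofReal_im,
      Complex.cosh_ofReal_im, Complex.sin_ofReal_im, Complex.sinh_ofReal_im]
  rw [Complex.norm_exp]
  congr 1
  simp [Complex.mul_re, hre]

/-- Imaginary part of the argument `r sin w · y` of the cosine factor. -/
theorem im_cosArg (r y : ℝ) (w : ℂ) :
    ((r : ℂ) * Complex.sin w * (y : ℂ)).im = r * (Real.cos w.re * Real.sinh w.im) * y := by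
  -- `Im sin(α + iψ) = cos α · sinh ψ`
  have him : (Complex.sin w).im = Real.cos w.re * Real.sinh w.im := by
    rw [Complex.sin_eq]
    simp [Complex.cos_ofReal_re, Complex.sinh_ofReal_re, Complex.cos_ofReal_im,
      Complex.sinh_ofReal_im, Complex.sin_ofReal_im, Complex.cosh_ofReal_im]
  simp [Complex.mul_im, him]

/-- Modulus bound of the cosine factor `cos(r sin w · y)` (`‖cos z‖ ≤ e^{|Im z|}` from
`cos z = (e^{iz} + e^{-iz})/2`). -/
theorem norm_cosFactor_le (r y : ℝ) (w : ℂ) :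
    ‖Complex.cos ((r : ℂ) * Complex.sin w * (y : ℂ))‖ ≤
      Real.exp (|r| * |Real.cos w.re| * |Real.sinh w.im| * |y|) := by
  have hcos : ∀ z : ℂ, ‖Complex.cos z‖ ≤ Real.exp |z.im| := by
    intro z
    rw [cos_eq_exp, norm_div, Complex.norm_two]
    have h1 : ‖cexp (z * I)‖ ≤ Real.exp |z.im| := by
      rw [Complex.norm_exp]
      exact Real.exp_le_exp.2 (by simp [neg_le_abs])
    have h2 : ‖cexp (-(z * I))‖ ≤ Real.exp |z.im| := by
      rw [Complex.norm_exp]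
      exact Real.exp_le_exp.2 (by simp [le_abs_self])
    calc ‖cexp (z * I) + cexp (-(z * I))‖ / 2
        ≤ (‖cexp (z * I)‖ + ‖cexp (-(z * I))‖) / 2 := by gcongr; exact norm_add_le _ _
      _ ≤ (Real.exp |z.im| + Real.exp |z.im|) / 2 := by gcongr
      _ = Real.exp |z.im| := by ring
  refine (hcos _).trans (le_of_eq ?_)
  rw [im_cosArg, abs_mul, abs_mul, abs_mul]
  ring_nf

/-- **The cone bound.** For `r ≥ 0`, `cos(Re w) ≥ 0` and `|y| ≤ x` the integrand
`e^{-(r cos w - ε) x} cos(r sin w · y)` has modulus `≤ exp(-(r cos(Re w) e^{-|Im w|} - ε) x)`. -/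
theorem norm_integrand_le {r ε : ℝ} (hr : 0 ≤ r) {w : ℂ} (hw : 0 ≤ Real.cos w.re) {x y : ℝ}
    (hxy : |y| ≤ x) :
    ‖cexp (-(((r : ℂ) * Complex.cos w - (ε : ℂ)) * (x : ℂ))) *
        Complex.cos ((r : ℂ) * Complex.sin w * (y : ℂ))‖ ≤
      Real.exp (-((r * Real.cos w.re * Real.exp (-|w.im|) - ε) * x)) := by
  -- `cosh ψ - |sinh ψ| = e^{-|ψ|}`
  have hcs : Real.cosh w.im - |Real.sinh w.im| = Real.exp (-|w.im|) := by
    rcases le_or_gt 0 w.im with h | h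
    · rw [abs_of_nonneg (Real.sinh_nonneg_iff.2 h), abs_of_nonneg h, Real.cosh_sub_sinh]
    · rw [abs_of_neg (Real.sinh_neg_iff.2 h), abs_of_neg h, sub_neg_eq_add, neg_neg,
        Real.cosh_add_sinh]
  rw [norm_mul, norm_expFactor, ← hcs]
  calc Real.exp (-((r * (Real.cos w.re * Real.cosh w.im) - ε) * x)) *
        ‖Complex.cos ((r : ℂ) * Complex.sin w * (y : ℂ))‖
      ≤ Real.exp (-((r * (Real.cos w.re * Real.cosh w.im) - ε) * x)) *
          Real.exp (|r| * |Real.cos w.re| * |Real.sinh w.im| * |y|) := by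
        gcongr
        exact norm_cosFactor_le r y w
    _ ≤ Real.exp (-((r * (Real.cos w.re * Real.cosh w.im) - ε) * x)) *
          Real.exp (r * Real.cos w.re * |Real.sinh w.im| * x) := by
        rw [abs_of_nonneg hr, abs_of_nonneg hw]
        gcongr
    _ = Real.exp (-((r * Real.cos w.re * (Real.cosh w.im - |Real.sinh w.im|) - ε) * x)) := by
        rw [← Real.exp_add]
        congr 1
        ring

/-- Monotonicity of the cosine on the strip: `|a| < 3π/8` gives `cos(3π/8) < cos a`. -/
theorem cos_threshold_lt {a : ℝ} (ha : |a| < 3 * Real.pi / 8) :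
    Real.cos (3 * Real.pi / 8) < Real.cos a := by
  rw [← Real.cos_abs a]
  exact Real.cos_lt_cos_of_nonneg_of_le_pi (abs_nonneg a) (by linarith [Real.pi_pos]) ha

/-- On the strip `|a| < 3π/8` the cosine is nonnegative (`0 < cos(3π/8) < cos a`). -/
theorem cos_nonneg_of_abs_lt {a : ℝ} (ha : |a| < 3 * Real.pi / 8) : 0 ≤ Real.cos a := by
  have h0 : 0 < Real.cos (3 * Real.pi / 8) :=
    Real.cos_pos_of_mem_Ioo ⟨by linarith [Real.pi_pos], by linarith [Real.pi_pos]⟩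
  exact (h0.trans (cos_threshold_lt ha)).le

/-- On the rectangle `{|Re w| < 3π/8, |Im w| < Ψ}` the mass `m_w = r cos(Re w) e^{-|Im w|}`
dominates the shift: `ε ≤ m_w`. -/
theorem eps_le_mass {r ε Ψ : ℝ} (hr : 0 < r)
    (hεΨ : ε ≤ r * Real.cos (3 * Real.pi / 8) * Real.exp (-Ψ)) {a b : ℝ}
    (ha : |a| < 3 * Real.pi / 8) (hb : |b| < Ψ) :
    ε ≤ r * Real.cos a * Real.exp (-|b|) := by
  have hcos := cos_threshold_lt ha
  have hcosa : 0 ≤ Real.cos a := cos_nonneg_of_abs_lt ha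
  have hexp : Real.exp (-Ψ) ≤ Real.exp (-|b|) := Real.exp_le_exp.2 (by linarith)
  calc ε ≤ r * Real.cos (3 * Real.pi / 8) * Real.exp (-Ψ) := hεΨ
    _ ≤ r * Real.cos a * Real.exp (-|b|) :=
        mul_le_mul (mul_le_mul_of_nonneg_left hcos.le hr.le) hexp (Real.exp_pos _).le
          (mul_nonneg hr.le hcosa)

/-- **The cone bound on the rectangle**: the integrand has modulus `≤ 1` for `w` in the rectangle
and `p` on the cone. -/
theorem norm_integrand_le_one {r ε Ψ : ℝ} (hr : 0 < r)
    (hεΨ : ε ≤ r * Real.cos (3 * Real.pi / 8) * Real.exp (-Ψ)) {w : ℂ}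
    (hwre : |w.re| < 3 * Real.pi / 8) (hwim : |w.im| < Ψ) {x y : ℝ} (hxy : |y| ≤ x) :
    ‖cexp (-(((r : ℂ) * Complex.cos w - (ε : ℂ)) * (x : ℂ))) *
        Complex.cos ((r : ℂ) * Complex.sin w * (y : ℂ))‖ ≤ 1 := by
  refine (norm_integrand_le hr.le (cos_nonneg_of_abs_lt hwre) hxy).trans ?_
  rw [Real.exp_le_one_iff, neg_nonpos]
  exact mul_nonneg (sub_nonneg.2 (eps_le_mass hr hεΨ hwre hwim)) ((abs_nonneg y).trans hxy)

/-- The integrand is continuous in the momentum `p`. -/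
theorem continuous_integrand (r ε : ℝ) (w : ℂ) :
    Continuous fun p : EuclideanSpace ℝ (Fin 4) =>
      cexp (-(((r : ℂ) * Complex.cos w - (ε : ℂ)) * ((p 0 : ℝ) : ℂ))) *
        Complex.cos ((r : ℂ) * Complex.sin w * ((p 1 : ℝ) : ℂ)) := by
  fun_prop

/-- The integrand is entire in the complexified angle `w`. -/
theorem differentiable_integrand (r ε : ℝ) (p : EuclideanSpace ℝ (Fin 4)) :
    Differentiable ℂ fun w : ℂ =>
      cexp (-(((r : ℂ) * Complex.cos w - (ε : ℂ)) * ((p 0 : ℝ) : ℂ))) *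
        Complex.cos ((r : ℂ) * Complex.sin w * ((p 1 : ℝ) : ℂ)) := by
  fun_prop

/-- The rectangle `{|Re w| < 3π/8, |Im w| < Ψ}` is open. -/
theorem isOpen_rectangle (Ψ : ℝ) : IsOpen {w : ℂ | |w.re| < 3 * Real.pi / 8 ∧ |w.im| < Ψ} :=
  IsOpen.and (isOpen_lt (by fun_prop) continuous_const) (isOpen_lt (by fun_prop) continuous_const)

/-- At a real angle the integrand splits into the two Laplace–Fourier kernels at
`(t, b) = (r cos α - ε, ± r sin α)`. -/
theorem integrand_real (r ε α x y : ℝ) :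
    cexp (-(((r : ℂ) * Complex.cos α - (ε : ℂ)) * (x : ℂ))) *
        Complex.cos ((r : ℂ) * Complex.sin α * (y : ℂ)) =
      (cexp ((((-((r * Real.cos α - ε) * x)) : ℝ) : ℂ) + ((r * Real.sin α * y : ℝ) : ℂ) * I) +
        cexp ((((-((r * Real.cos α - ε) * x)) : ℝ) : ℂ) + ((-(r * Real.sin α) * y : ℝ) : ℂ) * I)) /
        2 := by
  have eA : (((-((r * Real.cos α - ε) * x)) : ℝ) : ℂ) =
      -(((r : ℂ) * Complex.cos α - (ε : ℂ)) * (x : ℂ)) := by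
    push_cast; ring
  have eB : ((r * Real.sin α * y : ℝ) : ℂ) * I = (r : ℂ) * Complex.sin α * (y : ℂ) * I := by
    push_cast; ring
  have eC : ((-(r * Real.sin α) * y : ℝ) : ℂ) * I = -((r : ℂ) * Complex.sin α * (y : ℂ) * I) := by
    push_cast; ring
  rw [eA, eB, eC, Complex.exp_add, Complex.exp_add,
    cos_eq_exp ((r : ℂ) * Complex.sin α * (y : ℂ))]
  ring

/-- On the imaginary axis the integrand is the real nonnegative number
`e^{-(r cosh χ - ε) x} cosh(r sinh χ · y)`. -/
theorem integrand_imaginary (r ε χ x y : ℝ) :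
    cexp (-(((r : ℂ) * Complex.cos (χ * I) - (ε : ℂ)) * (x : ℂ))) *
        Complex.cos ((r : ℂ) * Complex.sin (χ * I) * (y : ℂ)) =
      ((Real.exp (-((r * Real.cosh χ - ε) * x)) * Real.cosh (r * Real.sinh χ * y) : ℝ) : ℂ) := by
  rw [Complex.cos_mul_I, Complex.sin_mul_I,
    show (r : ℂ) * (Complex.sinh χ * I) * (y : ℂ) = ((r : ℂ) * Complex.sinh χ * (y : ℂ)) * I by
      ring,
    Complex.cos_mul_I]
  push_cast
  ring

end AngularChart

open AngularChart in
/-- **Stub · the complexified-angle chart of a cone-supported Laplace–Fourier measure** (M/L;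
first half of the lead's stub 7). For a finite measure `μ` on energy–momentum space carried by the
light cone `{p₀ ≥ |p₁|}`, radius `r > 0`, shift `ε > 0` and depth `Ψ > 0` with
`ε ≤ r cos(3π/8) e^{-Ψ}`, the symmetrised chart
`H(w) = ∫ e^{-(r cos w - ε) p₀} cos(r sin w · p₁) dμ` is: holomorphic on the rectangle
`{|Re w| < 3π/8, |Im w| < Ψ}` (dominated holomorphic parameter integral: on the cone the integrand
has modulus `≤ e^{-(r cos(Re w) e^{-|Im w|} - ε) p₀} ≤ 1`,
`cosh ψ - |sinh ψ| = e^{-|ψ|}`); bounded there by the Laplace transform of `μ` at time `m_w - ε`,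
`m_w = r cos(Re w) e^{-|Im w|}` (written in the shape of the axis representations, `b = 0`); equal
at real `α` to the average of the two Laplace–Fourier integrals at
`(t, b) = (r cos α - ε, ± r sin α)` (`cos θ = (e^{iθ} + e^{-iθ})/2`); even; and REAL NONNEGATIVE on
the imaginary axis (`cos(i x) = cosh x > 0`). -/
theorem stub_angularChart (μ : Measure (EuclideanSpace ℝ (Fin 4))) [IsFiniteMeasure μ]
    (hE : μ {p | p 0 < 0} = 0) (hcone : μ {p | p 0 < |p 1|} = 0)
    (r ε Ψ : ℝ) (hr : 0 < r) (_hε : 0 < ε) (hΨ : 0 < Ψ)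
    (hεΨ : ε ≤ r * Real.cos (3 * Real.pi / 8) * Real.exp (-Ψ))
    (H : ℂ → ℂ)
    (hH : ∀ w : ℂ, H w = ∫ p, cexp (-(((r : ℂ) * Complex.cos w - (ε : ℂ)) * ((p 0 : ℝ) : ℂ))) *
      Complex.cos ((r : ℂ) * Complex.sin w * ((p 1 : ℝ) : ℂ)) ∂μ) :
    DifferentiableOn ℂ H {w : ℂ | |w.re| < 3 * Real.pi / 8 ∧ |w.im| < Ψ} ∧
    (∀ w : ℂ, |w.re| < 3 * Real.pi / 8 → |w.im| < Ψ →
      ‖H w‖ ≤ ‖∫ p, cexp ((((-((r * Real.cos w.re * Real.exp (-|w.im|) - ε) * p 0)) : ℝ) : ℂ) +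
        (((0 : ℝ) * p 1 : ℝ) : ℂ) * I) ∂μ‖) ∧
    (∀ α : ℝ, |α| < 3 * Real.pi / 8 →
      H α = ((∫ p, cexp ((((-((r * Real.cos α - ε) * p 0)) : ℝ) : ℂ) +
                ((r * Real.sin α * p 1 : ℝ) : ℂ) * I) ∂μ) +
             ∫ p, cexp ((((-((r * Real.cos α - ε) * p 0)) : ℝ) : ℂ) +
                ((-(r * Real.sin α) * p 1 : ℝ) : ℂ) * I) ∂μ) / 2) ∧
    (∀ w : ℂ, H (-w) = H w) ∧
    (∀ χ : ℝ, |χ| < Ψ → (H (χ * I)).im = 0 ∧ 0 ≤ (H (χ * I)).re) := by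
  -- the light cone, `μ`-a.e.
  have hae0 : ∀ᵐ p ∂μ, 0 ≤ p 0 := by
    rw [ae_iff]
    simpa only [not_le] using hE
  have hae1 : ∀ᵐ p ∂μ, |p 1| ≤ p 0 := by
    rw [ae_iff]
    simpa only [not_le] using hcone
  refine ⟨?_, ?_, ?_, ?_, ?_⟩
  · -- (1) holomorphy: a dominated holomorphic parameter integral
    rw [show H = fun w => ∫ p, cexp (-(((r : ℂ) * Complex.cos w - (ε : ℂ)) * ((p 0 : ℝ) : ℂ))) *
        Complex.cos ((r : ℂ) * Complex.sin w * ((p 1 : ℝ) : ℂ)) ∂μ from funext hH]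
    refine Literature.Analysis.Complex.differentiableOn_integral_of_dominated
      (fun w _ => (continuous_integrand r ε w).aestronglyMeasurable)
      (Filter.Eventually.of_forall fun p => (differentiable_integrand r ε p).differentiableOn)
      fun x₀ hx₀ => ?_
    obtain ⟨R, hR, hball⟩ := Metric.isOpen_iff.mp (isOpen_rectangle Ψ) x₀ hx₀
    refine ⟨R, hR, hball, fun _ => 1, integrable_const _, ?_⟩
    filter_upwards [hae1] with p hp1
    intro w hw
    obtain ⟨hwre, hwim⟩ := hball hw
    exact norm_integrand_le_one hr hεΨ hwre hwim hp1
  · -- (2) the cone bound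
    intro w hwre hwim
    have hm : ε ≤ r * Real.cos w.re * Real.exp (-|w.im|) := eps_le_mass hr hεΨ hwre hwim
    have hcw : 0 ≤ Real.cos w.re := cos_nonneg_of_abs_lt hwre
    have hR : (∫ p, cexp ((((-((r * Real.cos w.re * Real.exp (-|w.im|) - ε) * p 0)) : ℝ) : ℂ) +
        (((0 : ℝ) * p 1 : ℝ) : ℂ) * I) ∂μ) =
        ((∫ p, Real.exp (-((r * Real.cos w.re * Real.exp (-|w.im|) - ε) * p 0)) ∂μ : ℝ) : ℂ) := by
      rw [← integral_complex_ofReal]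
      refine integral_congr_ae (ae_of_all _ fun p => ?_)
      simp only [zero_mul, Complex.ofReal_zero, add_zero, Complex.ofReal_exp]
    rw [hR, Complex.norm_of_nonneg (integral_nonneg fun p => (Real.exp_pos _).le), hH]
    refine norm_integral_le_of_norm_le ?_ ?_
    · refine Integrable.mono' (integrable_const (1 : ℝ))
        (Continuous.aestronglyMeasurable (by fun_prop)) ?_
      filter_upwards [hae0] with p hp
      rw [Real.norm_eq_abs, abs_of_nonneg (Real.exp_pos _).le, Real.exp_le_one_iff, neg_nonpos]
      exact mul_nonneg (sub_nonneg.2 hm) hp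
    · filter_upwards [hae1] with p hp1
      exact norm_integrand_le hr.le hcw hp1
  · -- (3) real points
    intro α hα
    have ht : ε ≤ r * Real.cos α := by
      have h := eps_le_mass hr hεΨ hα (show |(0 : ℝ)| < Ψ by simpa using hΨ)
      simpa using h
    have hint : ∀ b : ℝ, Integrable (fun p : EuclideanSpace ℝ (Fin 4) =>
        cexp ((((-((r * Real.cos α - ε) * p 0)) : ℝ) : ℂ) + ((b * p 1 : ℝ) : ℂ) * I)) μ := by
      intro b
      refine Integrable.mono' (integrable_const (1 : ℝ))
        (Continuous.aestronglyMeasurable (by fun_prop)) ?_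
      filter_upwards [hae0] with p hp
      rw [Complex.norm_exp, Real.exp_le_one_iff]
      simp only [Complex.add_re, Complex.ofReal_re, Complex.mul_re, Complex.I_re, mul_zero,
        Complex.ofReal_im, Complex.I_im, zero_mul, sub_zero, add_zero, neg_nonpos]
      exact mul_nonneg (sub_nonneg.2 ht) hp
    rw [hH, ← integral_add (hint (r * Real.sin α)) (hint (-(r * Real.sin α))), ← integral_div]
    exact integral_congr_ae (ae_of_all _ fun p => integrand_real r ε α (p 0) (p 1))
  · -- (4) evenness
    intro w
    simp only [hH, Complex.cos_neg, Complex.sin_neg, mul_neg, neg_mul]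
  · -- (5) the imaginary axis
    intro χ _hχ
    have hHχ : H (χ * I) = ((∫ p, Real.exp (-((r * Real.cosh χ - ε) * p 0)) *
        Real.cosh (r * Real.sinh χ * p 1) ∂μ : ℝ) : ℂ) := by
      rw [hH, ← integral_complex_ofReal]
      exact integral_congr_ae (ae_of_all _ fun p => integrand_imaginary r ε χ (p 0) (p 1))
    rw [hHχ, Complex.ofReal_im, Complex.ofReal_re]
    exact ⟨rfl, integral_nonneg fun p => mul_nonneg (Real.exp_pos _).le (Real.cosh_pos _).le⟩

end Summit.QuantumFields.YangMills.Cruxes.ShellRigidity.TransverseSmearingPlanarThreshold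

end
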